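import Summits.PneNP.PneNP.Theorems.PhaseTwinsPolyDepthTwinsAboveDefs

/-!
# Route PhaseTwins, crux `PolyDepthTwinsAbove` (stmt-PneNP-2719), line `parity-wired-ports`: stub `stub_duplicator`

Duplicator wins the bijective `K`-pebble game on the parity-wired graphs `pwGraph R W c` and `pwGraph R W c'`
for ANY two charge vectors `c, c'`, whenever the base `R` is an `η`-edge-expander on `M ≥ 2` vertices and
`6K < ηM`. The proof is the strategy of `CFIMatching.ckEquiv_mgraph` (Atserias–Dawar 2019, Lemma 3.2;
Cai–Fürer–Immerman 1992, §6) mutatis mutandis: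
* `pshift g`, the shift of the vertices by a dart function `g` constant on edges, is an isomorphism
  `pwGraph c ≅ pwGraph (c + ∂g)` (`pwGraph_adj_shift_iff`): the represented bits of an inner vertex move by
  `CFIMatching.bit_shift`, pair edges use the same slot on both copies, end slots depend only on `(side, j)`;
* the charges enter adjacency only at INNER vertices (`pwGraph_adj_congr`);
* a vertex needs `≤ 6` darts (`pneed`) and an inner vertex needs every dart at its base vertex, so in a
  position lying on the graph of `pshift g` with `(PNeed p, g)` admissible and locally consistent for the
  charge `c + c'` the shifted charge `c + ∂g` agrees with `c'` at every pebbled inner vertex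
  (`constraint_of_blocked`, `pch_eq_of_good`), whence positions are partial isomorphisms (`isPartialIso_of_good`);
* the forth move extends `g` to the needed darts of the new vertex (`extend_many`; budget
  `6(|p| + 1) ≤ 6K < ηM`) and Duplicator's bijection shifts every vertex by the extension chosen for its own
  needed darts (an involution, `stub_duplicator`).
-/

noncomputable section

open scoped Classical BigOperators

namespace Summit.PneNP.PneNP.Cruxes.PolyDepthTwinsAbove.ParityWiredPorts

open Finset
open Literature.Computability.Complexity.Expander (RotGraph)
open Literature.ModelTheory.FiniteModelTheory (CkEquiv IsPartialIso)
open Literature.ModelTheory.FiniteModelTheory.TseitinColouring (Dart EdgeExpansion bd DAdm LocCons restrictTo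
  extend_many dAdm_restrict locCons_restrict constraint_of_blocked locCons_empty dAdm_empty)
open Literature.ModelTheory.FiniteModelTheory.CFIMatching (bit_shift zmod2_add_self)

set_option linter.dupNamespace false

variable {M v m κ₁ κ₂ : ℕ}

/-! ### Shifts -/

/-- The shift of the vertices by a dart function `g`: a copy vertex `(δ, a, x)` and an end vertex
`(w, i, a, j)` move their bit by `g` of their dart, an inner vertex `(w, S', j)` moves its represented subset
by `g` restricted to the darts of its base vertex. -/
def pshift (g : Dart M 3 → ZMod 2) : PWVert M v κ₂ → PWVert M v κ₂
  | .inl (δ, a, x) => .inl (δ, a + g δ, x)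
  | .inr (.inl (w, i, a, j)) => .inr (.inl (w, i, a + g (w, i), j))
  | .inr (.inr (w, S', j)) => .inr (.inr (w, S' + (fun k => g (w, Fin.castSucc k)), j))

/-- Shifting twice is the identity. -/
theorem pshift_pshift (g : Dart M 3 → ZMod 2) (x : PWVert M v κ₂) : pshift g (pshift g x) = x := by
  rcases x with ⟨δ, a, x⟩ | ⟨w, i, a, j⟩ | ⟨w, S', j⟩
  · simp [pshift, add_assoc, zmod2_add_self]
  · simp [pshift, add_assoc, zmod2_add_self]
  · simp only [pshift, Sum.inr.injEq, Prod.mk.injEq, true_and, and_true]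
    funext k
    simp [add_assoc, zmod2_add_self]

/-- The shift is an involution. -/
theorem pshift_involutive (g : Dart M 3 → ZMod 2) :
    Function.Involutive (pshift (v := v) (κ₂ := κ₂) g) :=
  pshift_pshift g

/-- **The shift by a `g` constant on edges transports `pwRel c` to `pwRel (c + ∂g)`**: pair edges use the
same slot on both copies (only the bits are compared, at the same dart), the end slot of `(w, i, a, j)`
depends only on `(side, j)` and its copy dart is `(w, i)` or its reverse, and the represented bits of an inner
vertex transform by `CFIMatching.bit_shift`. -/
theorem pwRel_shift_iff (R : RotGraph M 3) (W : Wiring v m κ₁ κ₂) {g : Dart M 3 → ZMod 2}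
    (hg : ∀ δ, g (R.rot δ) = g δ) (c : Fin M → ZMod 2) (x y : PWVert M v κ₂) :
    pwRel R W (c + bd g) (pshift g x) (pshift g y) ↔ pwRel R W c x y := by
  rcases x with ⟨δ, a, x⟩ | ⟨w, i, a, j⟩ | ⟨w, S, j⟩ <;>
    rcases y with ⟨δ', a', y⟩ | ⟨w', i', a', j'⟩ | ⟨w', S', j'⟩ <;> simp only [pshift, pwRel]
  · -- copy / copy
    constructor
    · rintro (⟨rfl, ha, hadj⟩ | ⟨hc, rfl, ha, hj⟩)
      · exact Or.inl ⟨rfl, add_right_cancel ha, hadj⟩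
      · refine Or.inr ⟨hc, rfl, ?_, hj⟩
        rw [add_right_comm] at ha
        exact add_right_cancel ha
    · rintro (⟨rfl, rfl, hadj⟩ | ⟨hc, rfl, rfl, hj⟩)
      · exact Or.inl ⟨rfl, rfl, hadj⟩
      · exact Or.inr ⟨hc, rfl, add_right_comm _ _ _, hj⟩
  · -- end / copy
    have hce : g (canonEnd R (w, i)).1 = g (w, i) := by
      unfold canonEnd
      split_ifs
      · rfl
      · exact hg _
    constructor
    · rintro ⟨ha, rfl, hy⟩
      rw [hce] at ha
      exact ⟨add_right_cancel ha, rfl, hy⟩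
    · rintro ⟨rfl, rfl, hy⟩
      exact ⟨by rw [hce], rfl, hy⟩
  · -- inner / end
    constructor
    · rintro ⟨rfl, hj, h⟩
      refine ⟨rfl, hj, ?_⟩
      rw [bit_shift] at h
      exact add_right_cancel h
    · rintro ⟨rfl, hj, h⟩
      refine ⟨rfl, hj, ?_⟩
      rw [bit_shift, h]

/-- **Hence the shift is an isomorphism `pwGraph c ≅ pwGraph (c + ∂g)`.** -/
theorem pwGraph_adj_shift_iff (R : RotGraph M 3) (W : Wiring v m κ₁ κ₂) {g : Dart M 3 → ZMod 2}
    (hg : ∀ δ, g (R.rot δ) = g δ) (c : Fin M → ZMod 2) (x y : PWVert M v κ₂) :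
    (pwGraph R W (c + bd g)).Adj (pshift g x) (pshift g y) ↔ (pwGraph R W c).Adj x y := by
  simp only [pwGraph_adj, ne_eq, (pshift_involutive g).injective.eq_iff, pwRel_shift_iff R W hg]

/-! ### Charges only matter at inner vertices -/

/-- The charge read at a vertex: `c w` at an inner vertex with base vertex `w`, nothing (`0`) elsewhere (only the
inner–end clause of `pwRel` reads the charges, at the inner vertex's base). -/
def pch (c : Fin M → ZMod 2) : PWVert M v κ₂ → ZMod 2
  | .inr (.inr (w, _, _)) => c w
  | _ => 0

/-- Charge functions read identically at `x` and `y` generate the same adjacency. -/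
theorem pwRel_congr (R : RotGraph M 3) (W : Wiring v m κ₁ κ₂) {c c' : Fin M → ZMod 2} {x y : PWVert M v κ₂}
    (hx : pch c x = pch c' x) (hy : pch c y = pch c' y) : pwRel R W c x y ↔ pwRel R W c' x y := by
  rcases x with ⟨δ, a, x⟩ | ⟨w, i, a, j⟩ | ⟨w, S, j⟩ <;>
    rcases y with ⟨δ', a', y⟩ | ⟨w', i', a', j'⟩ | ⟨w', S', j'⟩ <;> simp only [pwRel, pch] at hx hy ⊢
  rw [hx]

/-- Charge functions read identically at `x` and `y` give the same adjacency. -/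
theorem pwGraph_adj_congr (R : RotGraph M 3) (W : Wiring v m κ₁ κ₂) {c c' : Fin M → ZMod 2}
    {x y : PWVert M v κ₂} (hx : pch c x = pch c' x) (hy : pch c y = pch c' y) :
    (pwGraph R W c).Adj x y ↔ (pwGraph R W c').Adj x y := by
  simp only [pwGraph_adj, pwRel_congr R W hx hy, pwRel_congr R W hy.symm hx.symm]

/-! ### Needed darts -/

/-- The darts whose values determine the shift of a vertex (for inner vertices: all darts of the base vertex
and their reverses, so that a pebbled inner vertex isolates its base vertex). -/
def pneed (R : RotGraph M 3) : PWVert M v κ₂ → Finset (Dart M 3)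
  | .inl (δ, _, _) => {δ, R.rot δ}
  | .inr (.inl (w, i, _, _)) => {((w, i) : Dart M 3), R.rot (w, i)}
  | .inr (.inr (w, _, _)) =>
      (univ.image fun i : Fin 3 => ((w, i) : Dart M 3)) ∪ (univ.image fun i : Fin 3 => R.rot (w, i))

/-- The needed darts are closed under reversal. -/
theorem rot_mem_pneed (R : RotGraph M 3) {x : PWVert M v κ₂} {δ : Dart M 3} (h : δ ∈ pneed R x) :
    R.rot δ ∈ pneed R x := by
  rcases x with ⟨δ', a, x⟩ | ⟨w, i, a, j⟩ | ⟨w, S, j⟩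
  · simp only [pneed, Finset.mem_insert, Finset.mem_singleton] at h ⊢
    rcases h with rfl | rfl
    · exact Or.inr rfl
    · exact Or.inl (R.rot_rot _)
  · simp only [pneed, Finset.mem_insert, Finset.mem_singleton] at h ⊢
    rcases h with rfl | rfl
    · exact Or.inr rfl
    · exact Or.inl (R.rot_rot _)
  · simp only [pneed, Finset.mem_union, Finset.mem_image, Finset.mem_univ, true_and] at h ⊢
    rcases h with ⟨i, rfl⟩ | ⟨i, rfl⟩
    · exact Or.inr ⟨i, rfl⟩
    · exact Or.inl ⟨i, (R.rot_rot _).symm⟩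

/-- A vertex needs at most `6` darts. -/
theorem card_pneed_le (R : RotGraph M 3) (x : PWVert M v κ₂) : (pneed R x).card ≤ 2 * 3 := by
  rcases x with ⟨δ, a, x⟩ | ⟨w, i, a, j⟩ | ⟨w, S, j⟩
  · simp only [pneed]; exact (Finset.card_insert_le _ _).trans (by simp)
  · simp only [pneed]; exact (Finset.card_insert_le _ _).trans (by simp)
  · simp only [pneed]
    refine (Finset.card_union_le _ _).trans ?_
    have h1 := Finset.card_image_le (s := (univ : Finset (Fin 3))) (f := fun i : Fin 3 => ((w, i) : Dart M 3))
    have h2 := Finset.card_image_le (s := (univ : Finset (Fin 3))) (f := fun i : Fin 3 => R.rot (w, i))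
    simp only [Finset.card_univ, Fintype.card_fin] at h1 h2
    omega

/-- An inner vertex at `w` needs every dart at `w`. -/
theorem mem_pneed_inner (R : RotGraph M 3) (w : Fin M) (S : Fin 2 → ZMod 2) (j : Fin κ₂) (i : Fin 3) :
    ((w, i) : Dart M 3) ∈ pneed R (.inr (.inr (w, S, j)) : PWVert M v κ₂) := by
  simp [pneed]

/-- A copy vertex needs its dart. -/
theorem mem_pneed_copy (R : RotGraph M 3) (δ : Dart M 3) (a : ZMod 2) (x : Fin v) :
    δ ∈ pneed R (.inl (δ, a, x) : PWVert M v κ₂) := by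
  simp [pneed]

/-- An end vertex needs its dart. -/
theorem mem_pneed_end (R : RotGraph M 3) (w : Fin M) (i : Fin 3) (a : ZMod 2) (j : Fin κ₂) :
    ((w, i) : Dart M 3) ∈ pneed R (.inr (.inl (w, i, a, j)) : PWVert M v κ₂) := by
  simp [pneed]

/-- Two dart functions agreeing on `pneed x` shift `x` identically. -/
theorem pshift_congr (R : RotGraph M 3) {g g' : Dart M 3 → ZMod 2} {x : PWVert M v κ₂}
    (h : ∀ δ ∈ pneed R x, g δ = g' δ) : pshift g x = pshift g' x := by
  rcases x with ⟨δ, a, x⟩ | ⟨w, i, a, j⟩ | ⟨w, S, j⟩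
  · simp only [pshift, h δ (mem_pneed_copy R δ a x)]
  · simp only [pshift, h (w, i) (mem_pneed_end R w i a j)]
  · simp only [pshift, Sum.inr.injEq, Prod.mk.injEq, true_and, and_true]
    funext k
    simp only [Pi.add_apply, h (w, Fin.castSucc k) (mem_pneed_inner R w S j _)]

/-- The shift does not change the needed darts. -/
theorem pneed_pshift (R : RotGraph M 3) (g : Dart M 3 → ZMod 2) (x : PWVert M v κ₂) :
    pneed R (pshift g x) = pneed R x := by
  rcases x with ⟨δ, a, x⟩ | ⟨w, i, a, j⟩ | ⟨w, S, j⟩ <;> rfl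

/-- The darts needed by a position. -/
def PNeed (R : RotGraph M 3) (p : Set (PWVert M v κ₂ × PWVert M v κ₂)) : Finset (Dart M 3) :=
  univ.filter fun δ => ∃ x ∈ p, δ ∈ pneed R x.1

/-- Membership in `PNeed`. -/
theorem mem_PNeed (R : RotGraph M 3) {p : Set (PWVert M v κ₂ × PWVert M v κ₂)} {δ : Dart M 3} :
    δ ∈ PNeed R p ↔ ∃ x ∈ p, δ ∈ pneed R x.1 := by
  simp [PNeed]

/-- `PNeed` is monotone. -/
theorem PNeed_mono (R : RotGraph M 3) {p q : Set (PWVert M v κ₂ × PWVert M v κ₂)} (h : q ⊆ p) :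
    PNeed R q ⊆ PNeed R p := by
  intro δ hδ
  rw [mem_PNeed] at hδ ⊢
  obtain ⟨x, hx, hδ⟩ := hδ
  exact ⟨x, h hx, hδ⟩

/-- `PNeed` is closed under reversal. -/
theorem rot_mem_PNeed (R : RotGraph M 3) {p : Set (PWVert M v κ₂ × PWVert M v κ₂)} {δ : Dart M 3}
    (h : δ ∈ PNeed R p) : R.rot δ ∈ PNeed R p := by
  rw [mem_PNeed] at h ⊢
  obtain ⟨x, hx, hδ⟩ := h
  exact ⟨x, hx, rot_mem_pneed R hδ⟩

/-- A pebbled vertex has its needed darts in `PNeed`. -/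
theorem pneed_subset_PNeed (R : RotGraph M 3) {p : Set (PWVert M v κ₂ × PWVert M v κ₂)}
    {x : PWVert M v κ₂ × PWVert M v κ₂} (hx : x ∈ p) : pneed R x.1 ⊆ PNeed R p :=
  fun _ hδ => (mem_PNeed R).2 ⟨x, hx, hδ⟩

/-- The empty position needs nothing. -/
theorem PNeed_empty (R : RotGraph M 3) : PNeed R (∅ : Set (PWVert M v κ₂ × PWVert M v κ₂)) = ∅ := by
  ext δ; simp [mem_PNeed]

/-- `PNeed` of an enlarged position. -/
theorem PNeed_insert (R : RotGraph M 3) (p : Set (PWVert M v κ₂ × PWVert M v κ₂))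
    (z : PWVert M v κ₂ × PWVert M v κ₂) : PNeed R (insert z p) = pneed R z.1 ∪ PNeed R p := by
  ext δ
  simp only [mem_PNeed, Set.mem_insert_iff, Finset.mem_union]
  constructor
  · rintro ⟨x, rfl | hx, hδ⟩
    · exact Or.inl hδ
    · exact Or.inr ⟨x, hx, hδ⟩
  · rintro (hδ | ⟨x, hx, hδ⟩)
    · exact ⟨z, Or.inl rfl, hδ⟩
    · exact ⟨x, Or.inr hx, hδ⟩

/-- A position with `|p|` pairs needs at most `6 |p|` darts. -/
theorem card_PNeed_le (R : RotGraph M 3) {p : Set (PWVert M v κ₂ × PWVert M v κ₂)} (hp : p.Finite) :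
    (PNeed R p).card ≤ 2 * 3 * p.ncard := by
  have heq : PNeed R p = hp.toFinset.biUnion fun x => pneed R x.1 := by
    ext δ; simp [mem_PNeed]
  rw [heq, Set.ncard_eq_toFinset_card p hp]
  refine (Finset.card_biUnion_le).trans ?_
  calc ∑ x ∈ hp.toFinset, (pneed R x.1).card ≤ ∑ _x ∈ hp.toFinset, 2 * 3 :=
        Finset.sum_le_sum fun x _ => card_pneed_le R x.1
    _ = 2 * 3 * hp.toFinset.card := by rw [Finset.sum_const, smul_eq_mul]; ring

/-! ### The strategy -/

section Strategy

variable {R : RotGraph M 3} (W : Wiring v m κ₁ κ₂) {η : ℝ} (hR : EdgeExpansion R η) (c c' : Fin M → ZMod 2)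
  (hM : 2 ≤ M) {K : ℕ} (hK : (2 * 3 * K : ℝ) < η * M)

include hM in
/-- In a WINNING POSITION — pebble pairs on the graph of the shift by an admissible partial assignment `g` of the
needed darts which is locally consistent for the charge `c + c'` — the shifted charge `c + ∂g` agrees with `c'`
at the base of every pebbled inner vertex (its own constraint holds by local consistency, all its darts being
blocked), so both charge functions are read identically at the shifted vertex. -/
theorem pch_eq_of_good {p : Set (PWVert M v κ₂ × PWVert M v κ₂)} {g : Dart M 3 → ZMod 2}
    (hcons : LocCons R (c + c') (PNeed R p) g) {x : PWVert M v κ₂ × PWVert M v κ₂} (hx : x ∈ p) :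
    pch (c + bd g) (pshift g x.1) = pch c' (pshift g x.1) := by
  obtain ⟨x1, x2⟩ := x
  rcases x1 with ⟨δ, a, x⟩ | ⟨w, i, a, j⟩ | ⟨w, S, j⟩
  · rfl
  · rfl
  · show (c + bd g) w = c' w
    have h := constraint_of_blocked R hcons hM fun i => pneed_subset_PNeed R hx (mem_pneed_inner R w S j i)
    rw [Pi.add_apply] at h ⊢
    have h2 := zmod2_add_self (c' w)
    linear_combination h - h2

include hM in
/-- **Winning positions are partial isomorphisms** `pwGraph c ⇀ pwGraph c'`. -/
theorem isPartialIso_of_good {p : Set (PWVert M v κ₂ × PWVert M v κ₂)} {g : Dart M 3 → ZMod 2}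
    (hadm : DAdm R (PNeed R p) g) (hcons : LocCons R (c + c') (PNeed R p) g)
    (hgraph : ∀ x ∈ p, x.2 = pshift g x.1) : IsPartialIso (pwGraph R W c) (pwGraph R W c') p := by
  refine ⟨fun x hx y hy => ?_, fun x hx y hy => ?_⟩
  · rw [hgraph x hx, hgraph y hy]
    exact ((pshift_involutive g).injective.eq_iff).symm
  · rw [hgraph x hx, hgraph y hy]
    rw [← pwGraph_adj_congr R W (pch_eq_of_good c c' hM hcons hx) (pch_eq_of_good c c' hM hcons hy)]
    exact (pwGraph_adj_shift_iff R W hadm.rot_eq c x.1 y.1).symm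

/-- Lifting pebbles keeps a position winning (restrict the partial assignment to the darts still needed). -/
theorem good_mono {p q : Set (PWVert M v κ₂ × PWVert M v κ₂)} {g : Dart M 3 → ZMod 2}
    (hadm : DAdm R (PNeed R p) g) (hcons : LocCons R (c + c') (PNeed R p) g)
    (hgraph : ∀ x ∈ p, x.2 = pshift g x.1) (hqp : q ⊆ p) :
    DAdm R (PNeed R q) (restrictTo (PNeed R q) g) ∧ LocCons R (c + c') (PNeed R q) (restrictTo (PNeed R q) g) ∧
      ∀ x ∈ q, x.2 = pshift (restrictTo (PNeed R q) g) x.1 := by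
  refine ⟨dAdm_restrict R hadm (fun δ hδ => rot_mem_PNeed R hδ),
    locCons_restrict R hadm hcons (PNeed_mono R hqp) (fun δ hδ => rot_mem_PNeed R hδ), fun x hx => ?_⟩
  rw [hgraph x (hqp hx)]
  refine pshift_congr R fun δ hδ => ?_
  have : δ ∈ PNeed R q := pneed_subset_PNeed R hx hδ
  simp [restrictTo, this]

include hR hK in
/-- Budget: a position with fewer than `K` pairs plus one more vertex needs fewer than `η M` darts. -/
theorem card_PNeed_lt {p : Set (PWVert M v κ₂ × PWVert M v κ₂)} (hp : p.Finite) (hpK : p.ncard < K)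
    (z : PWVert M v κ₂) : ((PNeed R p ∪ pneed R z).card : ℝ) < η * M := by
  have h1 : (PNeed R p ∪ pneed R z).card ≤ 2 * 3 * K := by
    refine (Finset.card_union_le _ _).trans ?_
    have := card_PNeed_le R hp
    have := card_pneed_le R z
    calc (PNeed R p).card + (pneed R z).card ≤ 2 * 3 * p.ncard + 2 * 3 := by omega
      _ = 2 * 3 * (p.ncard + 1) := by ring
      _ ≤ 2 * 3 * K := Nat.mul_le_mul_left _ hpK
  have _ := hR
  calc ((PNeed R p ∪ pneed R z).card : ℝ) ≤ ((2 * 3 * K : ℕ) : ℝ) := by exact_mod_cast h1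
    _ = 2 * 3 * K := by push_cast; ring
    _ < η * M := hK

end Strategy

/-- **S4 — Duplicator wins the bijective `K`-pebble game on `pwGraph R W c` and `pwGraph R W c'`** for any two
charge vectors, whenever `6K < ηM` (`R` an `η`-edge-expander of degree `3` on `M ≥ 2` vertices): the CFI gauge
`pshift` plus local consistency for the charge `c + c'` (Atserias–Dawar 2019, Lemma 3.2; the strategy of
`CFIMatching.ckEquiv_mgraph` verbatim). -/
theorem stub_duplicator {R : RotGraph M 3} {η : ℝ} (hR : EdgeExpansion R η) (hM : 2 ≤ M)
    (W : Wiring v m κ₁ κ₂) (c c' : Fin M → ZMod 2) {K : ℕ} (hK : (2 * 3 * K : ℝ) < η * M) :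
    CkEquiv K (pwGraph R W c) (pwGraph R W c') := by
  refine ⟨{ carrier := {p | p.Finite ∧ p.ncard ≤ K ∧ ∃ g, DAdm R (PNeed R p) g ∧
              LocCons R (c + c') (PNeed R p) g ∧ ∀ x ∈ p, x.2 = pshift g x.1}
            empty_mem := ?_
            finite_of_mem := fun p hp => hp.1
            ncard_le_of_mem := fun p hp => hp.2.1
            isPartialIso_of_mem := fun p hp => ?_
            mem_of_subset := fun p hp q hqp => ?_
            forth := fun p hp hpK => ?_ }⟩
  · refine ⟨Set.finite_empty, by simp, fun _ => 0, ?_, ?_, fun x hx => (Set.notMem_empty x hx).elim⟩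
    · rw [PNeed_empty]; exact dAdm_empty R
    · rw [PNeed_empty]; exact locCons_empty R hR (c + c')
  · obtain ⟨g, hadm, hcons, hgraph⟩ := hp.2.2
    exact isPartialIso_of_good W c c' hM hadm hcons hgraph
  · obtain ⟨g, hadm, hcons, hgraph⟩ := hp.2.2
    exact ⟨hp.1.subset hqp, (Set.ncard_le_ncard hqp hp.1).trans hp.2.1, _, good_mono c c' hadm hcons hgraph hqp⟩
  · obtain ⟨hpfin, -, g, hgadm, hgcons, hgraph⟩ := hp
    -- the chosen extensions, one for each set of extra darts
    have hex : ∀ z : PWVert M v κ₂, ∃ g', DAdm R (PNeed R p ∪ pneed R z) g' ∧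
        LocCons R (c + c') (PNeed R p ∪ pneed R z) g' ∧ ∀ δ ∈ PNeed R p, g' δ = g δ := fun z =>
      extend_many R hR (pneed R z) (fun δ hδ => rot_mem_pneed R hδ) _ (PNeed R p) g le_rfl hgadm hgcons
        (card_PNeed_lt hR hK hpfin hpK z)
    have hexS : ∀ S : Finset (Dart M 3), (∃ z : PWVert M v κ₂, pneed R z = S) →
        ∃ g', DAdm R (PNeed R p ∪ S) g' ∧ LocCons R (c + c') (PNeed R p ∪ S) g' ∧
          ∀ δ ∈ PNeed R p, g' δ = g δ := by
      rintro S ⟨z, rfl⟩; exact hex z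
    set E : Finset (Dart M 3) → Dart M 3 → ZMod 2 := fun S =>
      if h : ∃ z : PWVert M v κ₂, pneed R z = S then Classical.choose (hexS S h) else g with hE
    have hEspec : ∀ z : PWVert M v κ₂, DAdm R (PNeed R p ∪ pneed R z) (E (pneed R z)) ∧
        LocCons R (c + c') (PNeed R p ∪ pneed R z) (E (pneed R z)) ∧
          ∀ δ ∈ PNeed R p, E (pneed R z) δ = g δ := by
      intro z
      have h : ∃ z' : PWVert M v κ₂, pneed R z' = pneed R z := ⟨z, rfl⟩
      have hEz : E (pneed R z) = Classical.choose (hexS _ h) := by simp only [hE, dif_pos h]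
      rw [hEz]
      exact Classical.choose_spec (hexS _ h)
    -- Duplicator's bijection: shift each vertex by the extension chosen for its own needs
    set F : PWVert M v κ₂ → PWVert M v κ₂ := fun z => pshift (E (pneed R z)) z with hF
    have hFinv : Function.Involutive F := by
      intro z
      show pshift (E (pneed R (pshift (E (pneed R z)) z))) (pshift (E (pneed R z)) z) = z
      rw [pneed_pshift, pshift_pshift]
    refine ⟨hFinv.toPerm F, fun a => ?_⟩
    have hFa : (hFinv.toPerm F) a = F a := rfl
    rw [hFa]
    obtain ⟨hadm, hcons, heq⟩ := hEspec a
    refine ⟨hpfin.insert _, (Set.ncard_insert_le _ _).trans (Nat.succ_le_of_lt hpK), E (pneed R a),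
      ?_, ?_, ?_⟩
    · rw [PNeed_insert, Finset.union_comm]; exact hadm
    · rw [PNeed_insert, Finset.union_comm]; exact hcons
    · rintro x (rfl | hx)
      · rfl
      · rw [hgraph x hx]
        exact pshift_congr R fun δ hδ => (heq δ (pneed_subset_PNeed R hx hδ)).symm

end Summit.PneNP.PneNP.Cruxes.PolyDepthTwinsAbove.ParityWiredPorts
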